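import Literature.AnabelianGeometry.SemiGraphs.PSCCompactifiedNodeBridge
import HarnessLib

/-!
# [CombGC] Thm. 1.6 (ii), descent step for the NODES, the level-`U` PACKAGE along arbitrary presentations of
# `Π^cpt`: from "`ᾱ_U` group-theoretically edge-like" to the `α`-graphic-mod-`Ker↑` node bijection

Mochizuki, *A combinatorial version of the Grothendieck conjecture*, Tohoku Math. J. **59** (2007) [CombGC],
proof of Theorem 1.6 (ii), author's ms p. 14 l.18–24 (compactification step and "by Remark 1.4.4 … `α` is
group-theoretically edge-like"), render `paper:url-6994f81053dc` p0014; Prop. 1.2 (i) p. 8.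
[cite: MochizukiCombGC2007, Thm 1.6(ii) p.14]

PROOF-ONLY file (abc-iut cell, layer L3, `plan/L3/SUBDAG-CombGC-Thm16.md` row T16-L09b; writer's request
05:22:11Z: consumer-facing package for `restrictBD … bd` with ARBITRARY branch data and `compactifyAlong`
along ARBITRARY presentations, input "`ᾱ_U` group-theoretically edge-like" (his producer
`exists_compactified_gtEdgeLike_holds`); holder abc-iut-w5-d188; sequel to `PSCCompactifiedNodeBridge.lean`).
**`node_package_of_gtEdgeLike`** — the level-`U` datum `∃ K' (normal in Π_H) (e : Node(G_U) ≃ Node(H_{U'})),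
(α-graphic modulo K') ∧ (separated modulo K')` consumed by `nodal_transport_of_graphic_mod` (p423994), with
`K' = (ker f')↑ = Ker(Π_{H_{U'}} ↠ Π^cpt)↑` and `e` DERIVED from the class correspondence
(`matched_node_of_gtEdgeLike` / `…'`) and the separation on both sides; also `conj_mod_ker_of_map` (pull-back
of the relation along `α⁻¹`, using `α((ker f)↑) = (ker f')↑`).  All levels ⇒ `α` carries nodal classes both
ways; with Thm. 1.6 (i) (`α` group-theoretically cuspidal) ⇒ `α` group-theoretically edge-like
(`isGroupTheoreticallyEdgeLike_of_nodal_of_cuspidal`).  Pure plumbing; no definitions; nothing here takes a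
side on [IUTchIII] Cor. 3.12.
-/

noncomputable section

namespace Literature.AnabelianGeometry.SemiGraphs

namespace PSCDatum

open scoped Pointwise
open PSCCovering

universe u

variable {P : Type u} [Group P] [TopologicalSpace P]
variable {P' : Type u} [Group P'] [TopologicalSpace P']
variable {Q : Type u} [Group Q] [TopologicalSpace Q]
variable {Q' : Type u} [Group Q'] [TopologicalSpace Q']
variable [IsTopologicalGroup P] [IsTopologicalGroup P'] [T2Space Q] [T2Space Q']
variable (G : PSCDatum P) (H : PSCDatum P') (α : P ≃ₜ* P')
variable (U : Subgroup P) [U.FiniteIndex] [U.Normal] (hU : IsOpen (U : Set P)) (bd : G.BranchData)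
variable (U' : Subgroup P') [U'.FiniteIndex] [U'.Normal] (hU' : IsOpen (U' : Set P')) (bd' : H.BranchData)
variable [CompactSpace U] [CompactSpace U']
variable (f : U →* Q) (hf : Continuous f) (hs : Function.Surjective f)
variable (f' : U' →* Q') (hf' : Continuous f') (hs' : Function.Surjective f')
variable (hUU' : U.map α.toMulEquiv.toMonoidHom = U')
variable (αU : U ≃ₜ* U') (hαU : ∀ u : U, ((αU u : U') : P') = α u)
variable (ᾱ : Q ≃ₜ* Q') (hᾱ : ∀ u : U, ᾱ (f u) = f' (αU u))
variable (hk : f.ker = (G.restrictBD U hU bd).cptKer) (hk' : f'.ker = (H.restrictBD U' hU' bd').cptKer)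

include hUU' hαU hᾱ in
omit [IsTopologicalGroup P] [IsTopologicalGroup P'] [T2Space Q] [T2Space Q'] [U.FiniteIndex] [U'.FiniteIndex]
  [CompactSpace U] [CompactSpace U'] [U.Normal] [U'.Normal] in
/-- The node relation "graphic modulo `(ker f')↑`" pulled back along `α⁻¹` (`α((ker f)↑) = (ker f')↑`).
[cite: MochizukiCombGC2007, Thm 1.6(ii) p.14] -/
theorem conj_mod_ker_of_map {v₁ v₂ : G.graph.N} {x₁ x₂ : P} {u' : P'} (hu' : u' ∈ U')
    (h : (U ⊓ ConjAct.toConjAct x₁ • G.nodeGp v₁).map α.toMulEquiv.toMonoidHom ⊔ f'.ker.map U'.subtype =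
      ConjAct.toConjAct u' • ((U ⊓ ConjAct.toConjAct x₂ • G.nodeGp v₂).map α.toMulEquiv.toMonoidHom ⊔
        f'.ker.map U'.subtype)) :
    ∃ u ∈ U, (U ⊓ ConjAct.toConjAct x₁ • G.nodeGp v₁) ⊔ f.ker.map U.subtype =
      ConjAct.toConjAct u • ((U ⊓ ConjAct.toConjAct x₂ • G.nodeGp v₂) ⊔ f.ker.map U.subtype) := by
  have hKeq := map_ker_eq_of_over α U U' αU hαU ᾱ.toMulEquiv hᾱ
  refine ⟨α.symm u', ?_, ?_⟩
  · have : u' ∈ U.map α.toMulEquiv.toMonoidHom := hUU' ▸ hu'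
    obtain ⟨u, hu, rfl⟩ := this
    change α.symm (α u) ∈ U
    rw [α.symm_apply_apply]
    exact hu
  · apply Subgroup.map_injective (f := α.toMulEquiv.toMonoidHom) α.injective
    rw [Subgroup.map_sup, hKeq, h, map_conj_smul, Subgroup.map_sup, hKeq]
    congr 2
    change u' = α (α.symm u')
    rw [α.apply_symm_apply]

include hUU' hαU hᾱ hk hk' in
/-- **PACKAGED node descent at one level, along arbitrary presentations of `Π^cpt`.**  From a
group-theoretically EDGE-LIKE `ᾱ_U : Q ≅ Q'` over `α|_U` between the compactified coverings
`(G.restrictBD U hU bd).compactifyAlong f`, `(H.restrictBD U' hU' bd').compactifyAlong f'` (`ker f`, `ker f'` the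
kernels of `↠ Π^cpt`) and Prop. 1.2 (i) for both compactified coverings (`EdgeLikeOpenInterDeterminesEdge`,
BY NAME), the level-`U` datum `∃ K' (normal) (e : Node(G_U) ≃ Node(H_{U'})), (α-graphic modulo K') ∧
(separated modulo K')` of p423994's `nodal_transport_of_graphic_mod` (`K' = (ker f')↑`, the node bijection
DERIVED by choice from the class correspondence).  Supplying it at every open normal `U` shows that `α`
carries nodal classes to nodal classes and back; with Thm. 1.6 (i), `α` is group-theoretically edge-like
(`isGroupTheoreticallyEdgeLike_of_nodal_of_cuspidal`). [cite: MochizukiCombGC2007, Thm 1.6(ii) p.14] -/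
theorem node_package_of_gtEdgeLike
    (hge : ((G.restrictBD U hU bd).compactifyAlong f hf hs).IsGroupTheoreticallyEdgeLike
      ((H.restrictBD U' hU' bd').compactifyAlong f' hf' hs') ᾱ)
    (hEG : ((G.restrictBD U hU bd).compactifyAlong f hf hs).EdgeLikeOpenInterDeterminesEdge)
    (hEH : ((H.restrictBD U' hU' bd').compactifyAlong f' hf' hs').EdgeLikeOpenInterDeterminesEdge) :
    ∃ (K' : Subgroup P') (_ : K'.Normal)
      (e : (Σ v, DoubleCoset.Quotient (U : Set P) (G.nodeGp v : Set P)) ≃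
        (Σ w, DoubleCoset.Quotient (U' : Set P') (H.nodeGp w : Set P'))),
      (∀ (v : G.graph.N) (x : P) (w : H.graph.N) (y : P'),
        e ⟨v, DoubleCoset.mk U (G.nodeGp v) x⟩ = ⟨w, DoubleCoset.mk U' (H.nodeGp w) y⟩ →
          ∃ u' ∈ U', (U ⊓ ConjAct.toConjAct x • G.nodeGp v).map α.toMulEquiv.toMonoidHom ⊔ K' =
            ConjAct.toConjAct u' • ((U' ⊓ ConjAct.toConjAct y • H.nodeGp w) ⊔ K')) ∧
      (∀ (w₁ : H.graph.N) (y₁ : P') (w₂ : H.graph.N) (y₂ : P'),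
        (∃ u' ∈ U', (U' ⊓ ConjAct.toConjAct y₁ • H.nodeGp w₁) ⊔ K' =
            ConjAct.toConjAct u' • ((U' ⊓ ConjAct.toConjAct y₂ • H.nodeGp w₂) ⊔ K')) →
          (⟨w₁, DoubleCoset.mk U' (H.nodeGp w₁) y₁⟩ :
              Σ w, DoubleCoset.Quotient (U' : Set P') (H.nodeGp w : Set P')) =
            ⟨w₂, DoubleCoset.mk U' (H.nodeGp w₂) y₂⟩) := by
  have hKn : (f'.ker.map U'.subtype).Normal := map_subtype_ker_normal H U' hU' bd' hk'
  have hKGn : (f.ker.map U.subtype).Normal := map_subtype_ker_normal G U hU bd hk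
  -- the relation "graphic modulo K″" between a level-`U` vertex group of `G` and one of `H`
  let R : G.graph.N → P → H.graph.N → P' → Prop := fun v x w y =>
    ∃ u' ∈ U', (U ⊓ ConjAct.toConjAct x • G.nodeGp v).map α.toMulEquiv.toMonoidHom ⊔
        f'.ker.map U'.subtype =
      ConjAct.toConjAct u' • ((U' ⊓ ConjAct.toConjAct y • H.nodeGp w) ⊔
        f'.ker.map U'.subtype)
  -- separation on the two sides
  have sepH : ∀ {w₁ y₁ w₂ y₂}, (∃ u' ∈ U', (U' ⊓ ConjAct.toConjAct y₁ • H.nodeGp w₁) ⊔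
        f'.ker.map U'.subtype = ConjAct.toConjAct u' •
        ((U' ⊓ ConjAct.toConjAct y₂ • H.nodeGp w₂) ⊔ f'.ker.map U'.subtype)) →
      (⟨w₁, DoubleCoset.mk U' (H.nodeGp w₁) y₁⟩ :
          Σ w, DoubleCoset.Quotient (U' : Set P') (H.nodeGp w : Set P')) =
        ⟨w₂, DoubleCoset.mk U' (H.nodeGp w₂) y₂⟩ :=
    fun h => sep_nodes_mod_of_edgeLikeOpenInter_compactifyAlong H U' hU' bd' f' hf' hs' hk' hEH h
  have sepG : ∀ {v₁ x₁ v₂ x₂}, (∃ u ∈ U, (U ⊓ ConjAct.toConjAct x₁ • G.nodeGp v₁) ⊔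
        f.ker.map U.subtype = ConjAct.toConjAct u •
        ((U ⊓ ConjAct.toConjAct x₂ • G.nodeGp v₂) ⊔ f.ker.map U.subtype)) →
      (⟨v₁, DoubleCoset.mk U (G.nodeGp v₁) x₁⟩ :
          Σ v, DoubleCoset.Quotient (U : Set P) (G.nodeGp v : Set P)) =
        ⟨v₂, DoubleCoset.mk U (G.nodeGp v₂) x₂⟩ :=
    fun h => sep_nodes_mod_of_edgeLikeOpenInter_compactifyAlong G U hU bd f hf hs hk hEG h
  -- (R1) changing representatives
  have R1 : ∀ {v x x' w y y'}, R v x w y → DoubleCoset.mk U (G.nodeGp v) x = DoubleCoset.mk U (G.nodeGp v) x' →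
      DoubleCoset.mk U' (H.nodeGp w) y = DoubleCoset.mk U' (H.nodeGp w) y' → R v x' w y' := by
    rintro v x x' w y y' ⟨u', hu', h⟩ hx hy
    obtain ⟨u₁, hu₁, h₁⟩ := exists_conj_of_mk_eq (inferInstance : U.Normal) (G.nodeGp v) hx
    obtain ⟨u₂, hu₂, h₂⟩ := exists_conj_of_mk_eq (inferInstance : U'.Normal) (H.nodeGp w) hy
    have hαu₁ : α u₁ ∈ U' := by rw [← hUU']; exact ⟨u₁, hu₁, rfl⟩
    refine ⟨α u₁ * u' * u₂⁻¹, U'.mul_mem (U'.mul_mem hαu₁ hu') (U'.inv_mem hu₂), ?_⟩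
    rw [h₁, map_conj_smul, ← conjAct_smul_sup_of_normal hKn]
    change ConjAct.toConjAct (α u₁) • _ = _
    rw [h, h₂, ← conjAct_smul_sup_of_normal hKn, ← mul_smul, ← mul_smul, ← map_mul, ← map_mul]
    congr 2
    group
  -- (R2) two `G`-vertices related to the same `H`-vertex coincide
  have R2 : ∀ {v₁ x₁ v₂ x₂ w y}, R v₁ x₁ w y → R v₂ x₂ w y →
      (⟨v₁, DoubleCoset.mk U (G.nodeGp v₁) x₁⟩ :
          Σ v, DoubleCoset.Quotient (U : Set P) (G.nodeGp v : Set P)) =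
        ⟨v₂, DoubleCoset.mk U (G.nodeGp v₂) x₂⟩ := by
    rintro v₁ x₁ v₂ x₂ w y ⟨u₁, hu₁, h₁⟩ ⟨u₂, hu₂, h₂⟩
    refine sepG (conj_mod_ker_of_map (G := G) (α := α) (U := U) (U' := U') (f := f) (f' := f') hUU' αU
      hαU ᾱ hᾱ (U'.mul_mem hu₁ (U'.inv_mem hu₂)) ?_)
    rw [h₁, map_mul, mul_smul, map_inv, eq_inv_smul_iff.mpr h₂.symm]
  -- (R3) two `H`-vertices related to the same `G`-vertex coincide
  have R3 : ∀ {v x w₁ y₁ w₂ y₂}, R v x w₁ y₁ → R v x w₂ y₂ →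
      (⟨w₁, DoubleCoset.mk U' (H.nodeGp w₁) y₁⟩ :
          Σ w, DoubleCoset.Quotient (U' : Set P') (H.nodeGp w : Set P')) =
        ⟨w₂, DoubleCoset.mk U' (H.nodeGp w₂) y₂⟩ := by
    rintro v x w₁ y₁ w₂ y₂ ⟨u₁, hu₁, h₁⟩ ⟨u₂, hu₂, h₂⟩
    refine sepH ⟨u₁⁻¹ * u₂, U'.mul_mem (U'.inv_mem hu₁) hu₂, ?_⟩
    rw [map_mul, mul_smul, ← h₂, map_inv, eq_inv_smul_iff, ← h₁]
  -- the matching function, by choice, and its properties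
  have hm : ∀ q : Σ v, DoubleCoset.Quotient (U : Set P) (G.nodeGp v : Set P),
      ∃ wy : Σ w, DoubleCoset.Quotient (U' : Set P') (H.nodeGp w : Set P'), ∃ y : P',
        wy.2 = DoubleCoset.mk U' (H.nodeGp wy.1) y ∧ R q.1 q.2.out wy.1 y := by
    intro q
    obtain ⟨w, y, hR⟩ := matched_node_of_gtEdgeLike G H α U hU bd U' hU' bd' f hf hs f' hf' hs' hUU'
      αU hαU ᾱ hᾱ hk' hge q.1 q.2.out
    exact ⟨⟨w, DoubleCoset.mk U' (H.nodeGp w) y⟩, y, rfl, hR⟩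
  choose φ yφ hyφ hRφ using hm
  have hφR : ∀ v x, R v x (φ ⟨v, DoubleCoset.mk U (G.nodeGp v) x⟩).1 (yφ ⟨v, DoubleCoset.mk U (G.nodeGp v) x⟩) :=
    fun v x => R1 (hRφ ⟨v, DoubleCoset.mk U (G.nodeGp v) x⟩) (DoubleCoset.out_eq' _ _ _) rfl
  have hφ_eq : ∀ v x, φ ⟨v, DoubleCoset.mk U (G.nodeGp v) x⟩ =
      ⟨(φ ⟨v, DoubleCoset.mk U (G.nodeGp v) x⟩).1,
        DoubleCoset.mk U' (H.nodeGp _) (yφ ⟨v, DoubleCoset.mk U (G.nodeGp v) x⟩)⟩ := by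
    intro v x
    have := hyφ ⟨v, DoubleCoset.mk U (G.nodeGp v) x⟩
    rcases hq : φ ⟨v, DoubleCoset.mk U (G.nodeGp v) x⟩ with ⟨w, q⟩
    rw [hq] at this
    dsimp only at this ⊢
    rw [this]
  have hinj : Function.Injective φ := by
    rintro ⟨v₁, q₁⟩ ⟨v₂, q₂⟩ hq
    obtain ⟨x₁, rfl⟩ : ∃ x₁, DoubleCoset.mk U (G.nodeGp v₁) x₁ = q₁ := ⟨q₁.out, DoubleCoset.out_eq' _ _ _⟩
    obtain ⟨x₂, rfl⟩ : ∃ x₂, DoubleCoset.mk U (G.nodeGp v₂) x₂ = q₂ := ⟨q₂.out, DoubleCoset.out_eq' _ _ _⟩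
    have h₁ := hφR v₁ x₁
    have h₂ := hφR v₂ x₂
    rw [hφ_eq] at hq
    conv_rhs at hq => rw [hφ_eq]
    obtain ⟨hw, hyy⟩ := Sigma.mk.inj_iff.mp hq
    revert h₂
    generalize (φ ⟨v₂, DoubleCoset.mk U (G.nodeGp v₂) x₂⟩).1 = w₂ at hw hyy
    intro h₂
    subst hw
    have hyy' := eq_of_heq hyy
    exact R2 h₁ (R1 h₂ rfl hyy'.symm)
  have hsurj : Function.Surjective φ := by
    rintro ⟨w, q⟩
    obtain ⟨y, rfl⟩ : ∃ y, DoubleCoset.mk U' (H.nodeGp w) y = q := ⟨q.out, DoubleCoset.out_eq' _ _ _⟩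
    obtain ⟨v, x, hR⟩ := matched_node_of_gtEdgeLike' G H α U hU bd U' hU' bd' f hf hs f' hf' hs' hUU'
      αU hαU ᾱ hᾱ hk' hge w y
    refine ⟨⟨v, DoubleCoset.mk U (G.nodeGp v) x⟩, ?_⟩
    rw [hφ_eq]
    exact R3 (hφR v x) hR
  refine ⟨f'.ker.map U'.subtype, hKn, Equiv.ofBijective φ ⟨hinj, hsurj⟩,
    ?_, fun w₁ y₁ w₂ y₂ h => sepH h⟩
  intro v x w y hexy
  rw [Equiv.ofBijective_apply, hφ_eq] at hexy
  obtain ⟨hw, hyy⟩ := Sigma.mk.inj_iff.mp hexy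
  have hR := hφR v x
  revert hR
  generalize (φ ⟨v, DoubleCoset.mk U (G.nodeGp v) x⟩).1 = w' at hw hyy
  intro hR
  subst hw
  exact R1 hR rfl (eq_of_heq hyy)


end PSCDatum

end Literature.AnabelianGeometry.SemiGraphs
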